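import Literature.AnabelianGeometry.SemiGraphs.ArithTemperedGroupLevelTopology
import Literature.AnabelianGeometry.SemiGraphs.ArithBTempCentraliserFree
import HarnessLib

/-!
# [SemiAnbd] Thm 5.4 (iii): the arithmetic `B^temp(φ)` COMPARED with the arithmetic level kernels of the outer
# models — vertex twists in the levels, small geometric traces, and the comparison lemma (helpers H2/H3)

Mochizuki, *Semi-graphs of anabelioids*, Publ. RIMS **42** (2006), §5 Def 5.1 (i) p. 62, Prop 5.2 (iv) p. 64
("natural exact sequences `1 → Π^temp_𝒢 → Π^temp_𝔊 → Π_A → 1`"), Thm 5.4 (iii) p. 66; §3 Thm 3.7 (i)/(ii) p. 40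
[cite: MochizukiSemiAnbd2006, Thm 5.4 (iii), p. 66].

abc-iut cell, D-0079 L-F sub-cell [SemiAnbd]+[CombGC] pack B, row F-1922 (Thm 5.4 (iii) at the outer models);
seat abc-iut-w4-d071 (gen 5); helpers H2/H3 toward discharging the design binder `hcont` (continuity of the
canonical `B^temp(φ)`) of the integrated Thm 5.4 line (`arithThm54_outerModels_chart_of_producers_anyRepresentatives`,
p447359) modulo [NS] = `FiniteIndexOpenOfTopFG` (F-1977; [IUTchI] Rmk 2.5.3 (vi) (O3)).  PROOF-ONLY, no definition.

* `SubgroupPresentation.exists_mem_level_isVConj_of_mem_levelKer` — an element of the arithmetic level kernel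
  `levelKer L` twists every vertex group by an element OF THE LEVEL: `Φ_x(H_w) = n H_w n⁻¹`, `n ∈ L` (it fixes
  the vertex `H_w 1 L`; vertex conjugators are unique up to `H_w`, Cor. 2.7 (i));
* `exists_comap_levelKer_le` — the geometric traces `ι⁻¹(levelKer (N n))` are eventually inside every open
  subgroup of `π₁^temp(𝒢)`: they equal `N n · (… ∩ H_{w₀})`, the second factor lies in the compact
  `C_n = {h ∈ H_{w₀} | [h, π₁^temp 𝒢] ⊆ N n} ↓ Z(π₁^temp 𝒢) ∩ H_{w₀} = 1` (temp-slimness, Prop 3.6 (iv));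
* `exists_map_eq_mul_conj_vertGp_mul` — THE COMPARISON: for `x ∈ levelKer (N n)` with
  `e(aug x) ∈ aug′(levelKer′(N′ m))` and `φ̂(N n) ≤ N′ m`, any homomorphism `B` of the outer models transporting
  the `Aut`-components along `φ̂` and covering `e` satisfies `B x ∈ levelKer′ · ι′(c₀ h c₀⁻¹) · levelKer′`,
  `h ∈ H′_w` — the vertex twists on both sides lie in the levels, `φ̂(H_v) = c₀ ψ_w(F_v Π_v) c₀⁻¹` is an open piece
  of a verticial subgroup (`Hom.conj_of_chartPullbackWith_iso`, local openness of `F`), and Thm 3.7 (ii)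
  commensurable terminality (`verticialDistinct_holds`) pins the free element `g′`.
Consumed by `ArithBTempContinuityOfFiniteIndexOpen.lean` (the continuity theorem).  Nothing here bears on
[IUTchIII] Cor. 3.12; typed ≠ proved elsewhere.
-/
namespace Literature.AnabelianGeometry.SemiGraphs

/-! ### H2: vertex twists of level-kernel elements lie in the level -/

namespace SemiGraph

namespace SubgroupPresentation

open CategoryTheory

universe u v

variable {𝔾 : SemiGraph.{u}} {Γ : Type u} [Group Γ] {E : Type v} [Group E]
variable (P : SubgroupPresentation 𝔾 Γ) {Φ : E →* MulAut Γ} {σ : E →* Aut 𝔾}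

/-- **Vertex twists of an element of the arithmetic level kernel lie in the level**: if
`e ∈ levelKer L` (acts trivially on the level-`L` coset semi-graph, trivially on `𝔾`, trivially on `Γ` mod
`L`), then for every vertex `w` there is `n ∈ L` with `Φ_e(H_w) = n H_w n⁻¹` — i.e. `n` is a vertex conjugator
(`e` fixes the vertex `H_w · 1 · L`, and vertex conjugators are unique up to `H_w`, Cor. 2.7 (i)).
[cite: MochizukiSemiAnbd2006, Prop 5.2 (iv), p. 64] -/
theorem exists_mem_level_isVConj_of_mem_levelKer (hP : P.IsArithCompatible Φ σ) (L : Subgroup Γ)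
    (hL : ∀ (e : E) (x : Γ), x ∈ L → Φ e x ∈ L) [L.Normal] {e : E} (he : e ∈ P.levelKer hP L hL)
    (w : 𝔾.Vertex) : ∃ n ∈ L, ∀ x : Γ, x ∈ P.H w ↔ n⁻¹ * Φ e x * n ∈ P.H w := by
  rw [mem_levelKer_iff] at he
  obtain ⟨hact, hσ, -⟩ := he
  obtain ⟨k, hk⟩ := hP.exists_isVConj e w
  have hw : (σ e).hom.vertexMap w = w := by rw [hσ]; rfl
  have hfix := congrArg (fun f : Aut (P.cosetGraph L) => f.hom.vertexMap (P.vMk L w 1)) hact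
  have hfix' : P.vMk L ((σ e).hom.vertexMap w) (k⁻¹ * Φ e 1) = P.vMk L w 1 := by
    rw [← P.arithAct_vertexMap_vMk hP L hL hk]; exact hfix
  have hz : P.vMk L w (k⁻¹ * Φ e 1) = P.vMk L w 1 := by
    rw [← hfix']; exact (P.vMk_eq L hw rfl).symm
  have key : DoubleCoset.mk (P.H w) L k⁻¹ = DoubleCoset.mk (P.H w) L 1 := by
    have := eq_of_heq (Sigma.mk.inj_iff.mp hz).2
    simpa using this
  obtain ⟨h, hh, c, hc, hhc⟩ := (DoubleCoset.eq _ _ _ _).mp key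
  -- `1 = h * k⁻¹ * c`, so `k = c * h`
  have hk' : k = c * h := by
    have h1 : k⁻¹ = h⁻¹ * c⁻¹ := by
      calc k⁻¹ = h⁻¹ * (h * k⁻¹ * c) * c⁻¹ := by group
        _ = h⁻¹ * c⁻¹ := by rw [← hhc]; group
    have := congrArg (·⁻¹) h1
    simpa [mul_inv_rev] using this
  refine ⟨c, hc, fun x => ?_⟩
  rw [hk x, hw, hk']
  -- `(c h)⁻¹ y (c h) ∈ H_w ↔ c⁻¹ y c ∈ H_w`
  constructor
  · intro hx
    have := (P.H w).mul_mem ((P.H w).mul_mem hh hx) (inv_mem hh)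
    have heq : c⁻¹ * Φ e x * c = h * ((c * h)⁻¹ * Φ e x * (c * h)) * h⁻¹ := by group
    rw [heq]
    exact this
  · intro hx
    have := (P.H w).mul_mem ((P.H w).mul_mem (inv_mem hh) hx) hh
    have heq : (c * h)⁻¹ * Φ e x * (c * h) = h⁻¹ * (c⁻¹ * Φ e x * c) * h := by group
    rw [heq]
    exact this

end SubgroupPresentation

end SemiGraph

namespace ProfiniteSemiGraph

open CategoryTheory Topology Filter
open Literature.AnabelianGeometry.EtaleTheta
open Literature.AnabelianGeometry.AbsoluteAnabelian

universe u

variable {𝒢 : ProfiniteSemiGraph.{u}} (c : TemperedPiChart 𝒢)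
  {PA : Type u} [Group PA] [TopologicalSpace PA] [IsTopologicalGroup PA]
  (ρ : PA →* TopOut c.G) (baseAct : PA →* Aut 𝒢.graph)

/-! ### Small geometric traces of the level kernels -/

section SmallLevels

variable (h36 : 𝒢.Prop36Hypotheses) (P : SemiGraph.SubgroupPresentation 𝒢.graph c.G)
  (hP : P.IsArithCompatible
    (((contMulAut c.G).subtype.comp (MonoidHom.fst (contMulAut c.G) PA)).comp
      (outerSemidirectProduct ρ).subtype)
    (baseAct.comp (outerSemidirectProductSnd ρ)))
  (w₀ : 𝒢.graph.Vertex) (hcpt : IsCompact (P.H w₀ : Set c.G))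
  (N : ℕ → Subgroup c.G) (hNn : ∀ n, (N n).Normal)
  (hNst : ∀ (n : ℕ) (e : outerSemidirectProduct ρ) (x : c.G), x ∈ N n →
    (((contMulAut c.G).subtype.comp (MonoidHom.fst (contMulAut c.G) PA)).comp
      (outerSemidirectProduct ρ).subtype) e x ∈ N n)
  (hNanti : Antitone N) (hNopen : ∀ n, IsOpen (N n : Set c.G))
  (hNcof : ∀ U ∈ 𝓝 (1 : c.G), ∃ n, (N n : Set c.G) ⊆ U)

include h36 hcpt hNn hNanti hNopen hNcof

omit [TopologicalSpace PA] [IsTopologicalGroup PA] in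
/-- **The geometric traces `ι⁻¹(levelKer (N n))` of the arithmetic level kernels are eventually inside
every open subgroup of `π₁^temp(𝒢)`.**  Indeed `ι⁻¹(levelKer (N n)) = N n · (ι⁻¹(levelKer (N n)) ∩ H_{w₀})`
(it fixes the vertex `H_{w₀} 1 (N n)`), the second factor lies in `C_n := {h ∈ H_{w₀} | [h, π₁^temp 𝒢] ⊆ N n}`
(centrality mod `N n`), the `C_n` are compact, antitone, with `⋂ₙ C_n = Z(π₁^temp 𝒢) ∩ H_{w₀} = 1`
(temp-slimness, Prop 3.6 (iv)); compactness. [cite: MochizukiSemiAnbd2006, Prop 5.2 (iv), p. 64] -/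
theorem exists_comap_levelKer_le (W : Subgroup c.G) (hW : IsOpen (W : Set c.G)) :
    ∃ n, (P.levelKer hP (N n) (hNst n)).comap (toOuterSemidirectProduct ρ) ≤ W := by
  -- notation
  set Φ := ((contMulAut c.G).subtype.comp (MonoidHom.fst (contMulAut c.G) PA)).comp
      (outerSemidirectProduct ρ).subtype with hΦdef
  have hιΦ : ∀ g : c.G, Φ (toOuterSemidirectProduct ρ g) = MulAut.conj g := fun g => rfl
  -- Hausdorff + centre-free
  haveI : T2Space c.G := by
    refine IsTopologicalGroup.t2Space_of_one_sep fun x hx => ?_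
    obtain ⟨M, hM⟩ := c.isTempered.separated x hx
    exact ⟨M, M.toOpenSubgroup.mem_nhds_one, hM⟩
  have hZ : Subgroup.center c.G = ⊥ := center_eq_bot_of_isSlimGroup (temperedPiSlim_holds 𝒢 h36 c)
  -- `⋂ₙ N n = {1}`
  have hNbot : ∀ x : c.G, (∀ n, x ∈ N n) → x = 1 := by
    intro x hx
    by_contra hx1
    obtain ⟨U, hU, hxU⟩ := t1Space_iff_exists_open.mp inferInstance (Ne.symm hx1)
    obtain ⟨n, hn⟩ := hNcof U (hU.mem_nhds hxU.1)
    exact hxU.2 (hn (hx n))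
  -- the compact sets `C_n`
  let C : ℕ → Set c.G := fun n => (P.H w₀ : Set c.G) ∩ {h | ∀ y : c.G, h * y * h⁻¹ * y⁻¹ ∈ N n}
  have hCclosed : ∀ n, IsClosed (C n) := by
    intro n
    refine hcpt.isClosed.inter ?_
    have : {h : c.G | ∀ y : c.G, h * y * h⁻¹ * y⁻¹ ∈ N n} = ⋂ y : c.G, (fun h => h * y * h⁻¹ * y⁻¹) ⁻¹' (N n) := by
      ext h; simp
    rw [this]
    refine isClosed_iInter fun y => ?_
    haveI := hNn n
    exact ((N n).isClosed_of_isOpen (hNopen n)).preimage (by fun_prop)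
  have hCcpt : ∀ n, IsCompact (C n) := fun n => hcpt.of_isClosed_subset (hCclosed n) Set.inter_subset_left
  have hCanti : Antitone C := fun m n hmn h hh => ⟨hh.1, fun y => hNanti hmn (hh.2 y)⟩
  have hCdir : Directed (· ⊇ ·) C := Antitone.directed_ge hCanti
  have hCinter : ∀ x ∈ ⋂ n, C n, x = 1 := by
    intro x hx
    rw [Set.mem_iInter] at hx
    have hxZ : x ∈ Subgroup.center c.G := by
      rw [Subgroup.mem_center_iff]
      intro y
      have h1 : x * y * x⁻¹ * y⁻¹ = 1 := hNbot _ fun n => (hx n).2 y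
      calc y * x = (x * y * x⁻¹ * y⁻¹)⁻¹ * (x * y) := by group
        _ = x * y := by rw [h1]; group
    rw [hZ] at hxZ
    exact hxZ
  -- some `C n ⊆ W` and some `N n' ⊆ W`
  have hW1 : (W : Set c.G) ∈ 𝓝 (1 : c.G) := hW.mem_nhds W.one_mem
  obtain ⟨n₁, hn₁⟩ := exists_subset_nhds_of_isCompact' hCdir hCcpt hCclosed
    (U := (W : Set c.G)) (fun x hx => by rw [hCinter x hx]; exact hW1)
  obtain ⟨n₂, hn₂⟩ := hNcof _ hW1
  refine ⟨max n₁ n₂, fun g hg => ?_⟩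
  haveI := hNn (max n₁ n₂)
  -- `g = c * h` with `c ∈ N`, `h ∈ H_{w₀}`; then `h ∈ ι⁻¹(levelKer)` too, so `h ∈ C`
  obtain ⟨c', hc', h, hh, rfl⟩ := P.exists_mem_level_mul_of_mem_comap_levelKer hP (N (max n₁ n₂))
    (hNst _) (toOuterSemidirectProduct ρ) hιΦ w₀ hg
  have hcW : c' ∈ W := hn₂ (hNanti (le_max_right n₁ n₂) hc')
  have hιc : toOuterSemidirectProduct ρ c' ∈ P.levelKer hP (N (max n₁ n₂)) (hNst _) :=
    P.le_comap_levelKer hP (N (max n₁ n₂)) (hNst _) (toOuterSemidirectProduct ρ) hιΦ (fun g => by simp) hc'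
  have hιh : toOuterSemidirectProduct ρ h ∈ P.levelKer hP (N (max n₁ n₂)) (hNst _) := by
    have := (P.levelKer hP (N (max n₁ n₂)) (hNst _)).mul_mem (inv_mem hιc) hg
    rwa [map_mul, inv_mul_cancel_left] at this
  have hhC : h ∈ C (max n₁ n₂) := by
    refine ⟨hh, fun y => ?_⟩
    have h3 := ((P.mem_levelKer_iff hP (N (max n₁ n₂)) (hNst _)).mp hιh).2.2 y
    rw [hιΦ, MulAut.conj_apply] at h3
    exact h3
  have hhW : h ∈ W := hn₁ (hCanti (le_max_left n₁ n₂) hhC)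
  exact W.mul_mem hcW hhW

end SmallLevels


/-! ### H3: the comparison — `B` takes values in `levelKer′ · ι′(c₀ H′_w c₀⁻¹)` on the open subgroup `O` -/

section Comparison

variable (P : SemiGraph.SubgroupPresentation 𝒢.graph c.G)
  (hP : P.IsArithCompatible
    (((contMulAut c.G).subtype.comp (MonoidHom.fst (contMulAut c.G) PA)).comp
      (outerSemidirectProduct ρ).subtype)
    (baseAct.comp (outerSemidirectProductSnd ρ)))
  (N : ℕ → Subgroup c.G) (hNn : ∀ n, (N n).Normal)
  (hNst : ∀ (n : ℕ) (e : outerSemidirectProduct ρ) (x : c.G), x ∈ N n →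
    (((contMulAut c.G).subtype.comp (MonoidHom.fst (contMulAut c.G) PA)).comp
      (outerSemidirectProduct ρ).subtype) e x ∈ N n)
  -- the `ℍ′` side
  {ℋ : ProfiniteSemiGraph.{u}} (c' : TemperedPiChart ℋ)
  {PA' : Type u} [Group PA'] [TopologicalSpace PA'] [IsTopologicalGroup PA']
  (ρ' : PA' →* TopOut c'.G) (baseAct' : PA' →* Aut ℋ.graph)
  (P' : SemiGraph.SubgroupPresentation ℋ.graph c'.G)
  (hP' : P'.IsArithCompatible
    (((contMulAut c'.G).subtype.comp (MonoidHom.fst (contMulAut c'.G) PA')).comp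
      (outerSemidirectProduct ρ').subtype)
    (baseAct'.comp (outerSemidirectProductSnd ρ')))
  (N' : ℕ → Subgroup c'.G) (hNn' : ∀ n, (N' n).Normal)
  (hNst' : ∀ (n : ℕ) (e : outerSemidirectProduct ρ') (x : c'.G), x ∈ N' n →
    (((contMulAut c'.G).subtype.comp (MonoidHom.fst (contMulAut c'.G) PA')).comp
      (outerSemidirectProduct ρ').subtype) e x ∈ N' n)
  -- the arrow: a locally open `F : 𝒢 → ℋ`, its chart-level representative `φ̂`, a vertex `v ↦ w` with the
  -- presentations' vertex groups verticial there, and the conjugator `c₀` of `Hom.conj_of_chartPullbackWith_iso`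
  (h37' : ℋ.Thm37Hypotheses) (F : Hom 𝒢 ℋ) (hF : F.IsLocallyOpen) (φc : c.G →ₜ* c'.G)
  (v : 𝒢.graph.Vertex) (ψv : 𝒢.Gv v →ₜ* c.G) (hψv : ψv.toMonoidHom.range = P.H v)
  (ψw : ℋ.Gv (F.base.vertexMap v) →ₜ* c'.G) (hψw : IsVerticialHom c' (F.base.vertexMap v) ψw)
  (hψw' : ψw.toMonoidHom.range = P'.H (F.base.vertexMap v))
  (c₀ : c'.G) (hc₀ : ∀ t, φc (ψv t) = c₀ * ψw (F.hV v t) * c₀⁻¹)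
  -- `B` and its laws: transport of the `Aut`-components along `φ̂`, covering `e`
  (e : PA →* PA') (B : outerSemidirectProduct ρ →* outerSemidirectProduct ρ')
  (hBfst : ∀ (x : outerSemidirectProduct ρ) (y : c.G),
    ((B x).1.1 : MulAut c'.G) (φc y) = φc ((x.1.1 : MulAut c.G) y))
  (hBaug : ∀ x, outerSemidirectProductSnd ρ' (B x) = e (outerSemidirectProductSnd ρ x))

include hNn hNn' h37' hF hψv hψw hψw' hc₀ hBfst hBaug

omit [TopologicalSpace PA] [IsTopologicalGroup PA] [TopologicalSpace PA'] [IsTopologicalGroup PA'] in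
/-- **The comparison lemma** (the heart of the (O3) route to the continuity of `B^temp(φ)`).  Let
`x ∈ levelKer (N n)` with `e(aug x) ∈ aug′(levelKer′ (N′ m))` and `φ̂(N n) ≤ N′ m`.  Then
`B x ∈ levelKer′(N′ m) · ι′(c₀ h c₀⁻¹) · levelKer′(N′ m)` for some `h ∈ H′_w`: writing `B x = ι′(g′) x₀′` with
`x₀′ ∈ levelKer′(N′ m)`, the vertex twists of `x` at `v` and of `x₀′` at `w` lie in the levels
(`exists_mem_level_isVConj_of_mem_levelKer`), `Ψ_{Bx}(φ̂ H_v) = φ̂(n₁) c₀ · ψ_w(F_v Π_v) · (φ̂(n₁) c₀)⁻¹` is an open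
piece of the verticial subgroup `a₁ H′_w a₁⁻¹` lying also in `a₂ H′_w a₂⁻¹`, `a₂ = g′ Ψ₀(c₀) n′`, so Thm 3.7 (ii)
(`verticialDistinct_holds`, commensurable terminality) gives `a₁⁻¹ a₂ ∈ H′_w`, which pins `g′`.
[cite: MochizukiSemiAnbd2006, Thm 5.4 (iii), p. 66] -/
theorem exists_map_eq_mul_conj_vertGp_mul {n m : ℕ} (hnm : N n ≤ (N' m).comap φc.toMonoidHom)
    {x : outerSemidirectProduct ρ} (hx : x ∈ P.levelKer hP (N n) (hNst n))
    (hx' : e (outerSemidirectProductSnd ρ x) ∈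
      (P'.levelKer hP' (N' m) (hNst' m)).map (outerSemidirectProductSnd ρ')) :
    ∃ h ∈ P'.H (F.base.vertexMap v), ∃ l₁ ∈ P'.levelKer hP' (N' m) (hNst' m),
      ∃ l₂ ∈ P'.levelKer hP' (N' m) (hNst' m),
        B x = l₁ * toOuterSemidirectProduct ρ' (c₀ * h * c₀⁻¹) * l₂ := by
  classical
  haveI := hNn n
  haveI := hNn' m
  set L' := P'.levelKer hP' (N' m) (hNst' m) with hL'def
  haveI hL'n : L'.Normal := P'.levelKer_normal hP' (N' m) (hNst' m)
  have hιΦ' : ∀ g : c'.G,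
      (((contMulAut c'.G).subtype.comp (MonoidHom.fst (contMulAut c'.G) PA')).comp
        (outerSemidirectProduct ρ').subtype) (toOuterSemidirectProduct ρ' g) = MulAut.conj g := fun g => rfl
  have hισ' : ∀ g : c'.G,
      (baseAct'.comp (outerSemidirectProductSnd ρ')) (toOuterSemidirectProduct ρ' g) = 1 := fun g => by simp
  have hι'L : ∀ g ∈ N' m, toOuterSemidirectProduct ρ' g ∈ L' := fun g hg =>
    P'.le_comap_levelKer hP' (N' m) (hNst' m) (toOuterSemidirectProduct ρ') hιΦ' hισ' hg
  -- (1) `x₀′ ∈ levelKer′` over `e (aug x)`, and `B x = ι′ g′ * x₀′`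
  obtain ⟨x₀, hx₀, hx₀aug⟩ := hx'
  obtain ⟨-, hex', -⟩ := outerAction_exact c' ρ' h37'.toProp36Hypotheses
  have hker : B x * x₀⁻¹ ∈ (outerSemidirectProductSnd ρ').ker := by
    rw [MonoidHom.mem_ker, map_mul, map_inv, hBaug, ← hx₀aug, mul_inv_cancel]
  rw [← hex'] at hker
  obtain ⟨g', hg'⟩ := hker
  have hBx : B x = toOuterSemidirectProduct ρ' g' * x₀ := by
    rw [hg', inv_mul_cancel_right]
  -- the `Aut`-components: `Ψ = conj g′ ∘ Ψ₀`
  have hΨ : ∀ z : c'.G, ((B x).1.1 : MulAut c'.G) z = g' * ((x₀.1.1 : MulAut c'.G) z) * g'⁻¹ := by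
    intro z; rw [hBx]; rfl
  -- (2) vertex twists in the levels, on both sides
  obtain ⟨n₁, hn₁, hn₁V⟩ := P.exists_mem_level_isVConj_of_mem_levelKer hP (N n) (hNst n) hx v
  obtain ⟨n', hn', hn'V⟩ :=
    P'.exists_mem_level_isVConj_of_mem_levelKer hP' (N' m) (hNst' m) hx₀ (F.base.vertexMap v)
  change ∀ y : c.G, y ∈ P.H v ↔ n₁⁻¹ * (x.1.1 : MulAut c.G) y * n₁ ∈ P.H v at hn₁V
  change ∀ y : c'.G, y ∈ P'.H (F.base.vertexMap v) ↔
    n'⁻¹ * (x₀.1.1 : MulAut c'.G) y * n' ∈ P'.H (F.base.vertexMap v) at hn'V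
  -- (3) the two conjugates of `H′_w` containing `Ψ(φ̂ H_v)`
  set a₁ : c'.G := φc n₁ * c₀ with ha₁
  set a₂ : c'.G := g' * (x₀.1.1 : MulAut c'.G) c₀ * n' with ha₂
  have hHw : P'.H (F.base.vertexMap v) ∈ verticialSubgroups c' (F.base.vertexMap v) := ⟨ψw, hψw, hψw'.symm⟩
  let Vw : Subgroup (ℋ.Gv (F.base.vertexMap v)) := (F.hV v).toMonoidHom.range
  let A₀ : Subgroup c'.G := (Vw.map ψw.toMonoidHom).map (MulAut.conj a₁).toMonoidHom
  have hinjψ : Function.Injective ψw := (verticialInjective_holds ℋ h37' c' (F.base.vertexMap v)).2 ψw hψw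
  -- `A₀` has finite index in `a₁ H′_w a₁⁻¹`
  have hA₀ne : A₀.relIndex ((P'.H (F.base.vertexMap v)).map (MulAut.conj a₁).toMonoidHom) ≠ 0 := by
    haveI : Vw.FiniteIndex := ArithOpenness.finiteIndex_of_isOpen_of_compactSpace Vw (hF.1 v)
    rw [← hψw', MonoidHom.range_eq_map,
      Subgroup.relIndex_map_map_of_injective _ _ (MulAut.conj a₁).injective,
      Subgroup.relIndex_map_map_of_injective _ _ hinjψ, Subgroup.relIndex_top_right]
    exact Subgroup.FiniteIndex.index_ne_zero
  -- `A₀ ≤ a₂ H′_w a₂⁻¹`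
  have hA₀le : A₀ ≤ (P'.H (F.base.vertexMap v)).map (MulAut.conj a₂).toMonoidHom := by
    rintro _ ⟨_, ⟨u, ⟨t, rfl⟩, rfl⟩, rfl⟩
    -- `a₁ ψ_w(F_v t) a₁⁻¹ = φ̂ (n₁ ψ_v t n₁⁻¹)`
    have h1 : (MulAut.conj a₁).toMonoidHom (ψw.toMonoidHom ((F.hV v).toMonoidHom t)) =
        φc (n₁ * ψv t * n₁⁻¹) := by
      change a₁ * ψw (F.hV v t) * a₁⁻¹ = φc (n₁ * ψv t * n₁⁻¹)
      rw [map_mul, map_mul, map_inv, hc₀, ha₁]; group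
    -- `n₁ ψ_v t n₁⁻¹ = Φ_x y` with `y ∈ H_v`
    set y : c.G := (x.1.1 : MulAut c.G)⁻¹ (n₁ * ψv t * n₁⁻¹) with hy
    have hΦy : (x.1.1 : MulAut c.G) y = n₁ * ψv t * n₁⁻¹ := by
      rw [hy]; exact MulEquiv.apply_symm_apply _ _
    have hyH : y ∈ P.H v := by
      rw [hn₁V y, hΦy, ← hψv]
      refine ⟨t, ?_⟩
      change ψv t = n₁⁻¹ * (n₁ * ψv t * n₁⁻¹) * n₁
      group
    obtain ⟨t₂, ht₂⟩ : y ∈ ψv.toMonoidHom.range := by rw [hψv]; exact hyH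
    -- `h₁ := ψ_w (F_v t₂) ∈ H′_w`, `Ψ₀ h₁ = n′ h₂ n′⁻¹` with `h₂ ∈ H′_w`
    have hh₁ : ψw (F.hV v t₂) ∈ P'.H (F.base.vertexMap v) := by rw [← hψw']; exact ⟨F.hV v t₂, rfl⟩
    set h₂ : c'.G := n'⁻¹ * (x₀.1.1 : MulAut c'.G) (ψw (F.hV v t₂)) * n' with hh₂def
    have hh₂ : h₂ ∈ P'.H (F.base.vertexMap v) := (hn'V _).mp hh₁
    refine ⟨h₂, hh₂, ?_⟩
    change a₂ * h₂ * a₂⁻¹ = _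
    rw [h1, ← hΦy, ← hBfst, hΨ, ← ht₂]
    change _ = g' * (x₀.1.1 : MulAut c'.G) (φc (ψv t₂)) * g'⁻¹
    rw [hc₀, map_mul, map_mul, map_inv, hh₂def, ha₂]
    group
  -- (4) commensurable terminality (Thm 3.7 (ii)): `a₁⁻¹ a₂ ∈ H′_w`
  have hmem : a₁⁻¹ * a₂ ∈ P'.H (F.base.vertexMap v) := by
    by_contra hnot
    have h0 := (verticialDistinct_holds ℋ h37' c').2 (F.base.vertexMap v) _ hHw a₁ a₂ hnot
    exact hA₀ne (Subgroup.relIndex_eq_zero_of_le_left hA₀le h0)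
  -- (5) assemble: `g′ = φ̂ n₁ · c₀ · h₃ · n′⁻¹ · (Ψ₀ c₀)⁻¹`
  set h₃ : c'.G := a₁⁻¹ * a₂ with hh₃
  have hg'eq : g' = φc n₁ * c₀ * h₃ * n'⁻¹ * ((x₀.1.1 : MulAut c'.G) c₀)⁻¹ := by
    rw [hh₃, ha₁, ha₂]; group
  have hconj : toOuterSemidirectProduct ρ' ((x₀.1.1 : MulAut c'.G) c₀) =
      x₀ * toOuterSemidirectProduct ρ' c₀ * x₀⁻¹ := (conj_toOuterSemidirectProduct ρ' x₀ c₀).symm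
  refine ⟨h₃, hmem, toOuterSemidirectProduct ρ' (φc n₁), hι'L _ (hnm hn₁),
    toOuterSemidirectProduct ρ' c₀ * ((toOuterSemidirectProduct ρ' n')⁻¹ * x₀) *
      (toOuterSemidirectProduct ρ' c₀)⁻¹,
    hL'n.conj_mem _ (L'.mul_mem (L'.inv_mem (hι'L _ hn')) hx₀) _, ?_⟩
  rw [hBx, hg'eq]
  simp only [map_mul, map_inv, hconj]
  group

end Comparison

end ProfiniteSemiGraph

end Literature.AnabelianGeometry.SemiGraphs
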